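import Literature.AnabelianGeometry.SemiGraphs.TemperedEdgeImagesOfPersistent
import Literature.AnabelianGeometry.SemiGraphs.TemperedFixedSystemOfFiniteImages
import Literature.AnabelianGeometry.SemiGraphs.TemperedFixedSystemsOfEdgeImages
import HarnessLib

/-!
# [SemiAnbd] Thm 3.7 (iii) beyond finite `𝔾`: (FIX∞) for a compact subgroup with a persistent base vertex at a locally finite `𝔾`

Mochizuki, *Semi-graphs of anabelioids*, Publ. RIMS **42** (2006), §3, Theorem 3.7 (iii), manuscript
p. 41 ("we may assume that there exists a compatible system of vertices of `𝒢_{∞,j}`, for `j ∈ J`, each of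
which is fixed by `H`. Also … if `H` fixes two vertices of `𝒢_{∞,j}`, then these two vertices are joined
to one another by a single [closed] edge") [cite: MochizukiSemiAnbd2006, Thm 3.7(iii) p.41].

PROOF-ONLY (cell abc-iut, layer L3, row T37iii·LOCFIN-PERSIST (B3), L3-lead ruling α91; seat
abc-iut-w6-d066; no definition, no new named fact).  From `pointOrEdge_images_of_persistent`
(`TemperedEdgeImagesOfPersistent.lean`): for the abstract level data with levels / immersions / finite
fibres / (I4′)_cpt, at a LOCALLY FINITE `𝔾`, a compact `C ≠ 1` with a persistent base vertex satisfies both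
clauses of (FIX∞) and the two metric binders of abc-iut-L3-t10's closer `compactInVerticialAt_of_noEscape`:

* `hadj_of_persistent_locFin` — distinct compatible `C`-fixed systems are the two ends of ONE edge of
  `𝒢_{∞,j}` through distinct branches, and that edge is `C`-fixed (tree: `SemiGraph.edge_unique_of_abuts`).

(`hfix` / `hbdd` and the canonical-tower instance with the `CompactInVerticialAt` corollary:
`TemperedCompactInVerticialAtOfPersistentLocFin.lean`.)  Nothing here bears on [IUTchIII] Cor. 3.12.
-/

namespace Literature.AnabelianGeometry.SemiGraphs

namespace ProfiniteSemiGraph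

namespace VerticialLevelData

open CategoryTheory Topology

universe v u

variable {𝒢 : ProfiniteSemiGraph.{u}} {c : TemperedPiChart 𝒢} (D : VerticialLevelData.{v} 𝒢 c)

section Levels

/-! ### The level structure (abstract): levels, immersions, actions, transitions, projections -/

variable (level : D.J → SemiGraph.{u}) (quot : ∀ j, D.tree j ⟶ level j)
  (levelAct : ∀ j, c.G →* Aut (level j))
  (levelTrans : ∀ ⦃i j : D.J⦄, i ≤ j → (level j ⟶ level i))
  (levelProj : ∀ j, level j ⟶ 𝒢.graph)

/-- The common hypothesis package of the three (FIX∞) corollaries below, spelled out each time (no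
definition): level structure with immersions, equivariance and transition squares, finite level fibres
over `𝔾`, local finiteness of `𝔾`, (I4′)_cpt, a persistent base vertex: at every level two compatible `C`-fixed
systems coincide or are the two ends of one edge. [cite: MochizukiSemiAnbd2006, Thm 3.7(iii) p.41] -/
private theorem pointOrEdge_aux' (h𝒢 : 𝒢.Thm37Hypotheses) (C : Subgroup c.G) (hC1 : C ≠ ⊥)
    (quot_isImmersion : ∀ j, SemiGraph.IsImmersion (quot j))
    (act_quot : ∀ (j : D.J) (g : c.G), (D.act j g).hom ≫ quot j = quot j ≫ (levelAct j g).hom)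
    (trans_quot : ∀ ⦃i j : D.J⦄ (h : i ≤ j), D.trans h ≫ quot i = quot j ≫ levelTrans h)
    (levelTrans_id : ∀ j, levelTrans (le_refl j) = 𝟙 (level j))
    (levelTrans_comp : ∀ ⦃i j k : D.J⦄ (hij : i ≤ j) (hjk : j ≤ k),
      levelTrans hjk ≫ levelTrans hij = levelTrans (hij.trans hjk))
    (quot_proj : ∀ j, quot j ≫ levelProj j = D.proj j)
    (levelTrans_proj : ∀ ⦃i j : D.J⦄ (h : i ≤ j), levelTrans h ≫ levelProj i = levelProj j)
    (finV : ∀ (j : D.J) (v : 𝒢.graph.Vertex), {w : (level j).Vertex | (levelProj j).vertexMap w = v}.Finite)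
    (finB : ∀ (j : D.J) (b : 𝒢.graph.Branch), {β : (level j).Branch | (levelProj j).branchMap β = b}.Finite)
    (hlf : ∀ v : 𝒢.graph.Vertex, {b : 𝒢.graph.Branch | 𝒢.graph.abuts b = some v}.Finite)
    (stabC : ∀ (j₀ : D.J) (w : ∀ i : {i : D.J // j₀ ≤ i}, (level i.1).Vertex)
      (β β' : ∀ i : {i : D.J // j₀ ≤ i}, (level i.1).Branch),
      (∀ i, β i ≠ β' i ∧ (level i.1).abuts (β i) = some (w i) ∧ (level i.1).abuts (β' i) = some (w i)) →
      (∀ ⦃i i' : {i : D.J // j₀ ≤ i}⦄ (h : i.1 ≤ i'.1), (levelTrans h).vertexMap (w i') = w i ∧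
        (levelTrans h).branchMap (β i') = β i ∧ (levelTrans h).branchMap (β' i') = β' i) →
      ∃ (Q : Type u) (_ : Group Q) (ιQ : c.G →* Q) (v : 𝒢.graph.Vertex) (b b' : 𝒢.graph.Branch)
        (hb : 𝒢.graph.abuts b = some v) (hb' : 𝒢.graph.abuts b' = some v) (ψ : 𝒢.Gv v →* Q) (x x' : 𝒢.Gv v),
        Set.InjOn ιQ C ∧ Function.Injective ψ ∧ (b' ≠ b ∨ x⁻¹ * x' ∉ 𝒢.branchSubgroup b v hb) ∧
        ∀ g ∈ C, (∀ i, (levelAct i.1 g).hom.vertexMap (w i) = w i ∧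
          (levelAct i.1 g).hom.branchMap (β i) = β i ∧ (levelAct i.1 g).hom.branchMap (β' i) = β' i) →
          ιQ g ∈ ((𝒢.branchSubgroup b v hb).map (MulAut.conj x).toMonoidHom).map ψ ⊓
            ((𝒢.branchSubgroup b' v hb').map (MulAut.conj x').toMonoidHom).map ψ)
    (v : 𝒢.graph.Vertex)
    (hpers : ∀ j, ∃ x : (D.tree j).Vertex, (D.proj j).vertexMap x = v ∧
      ∀ g ∈ C, (D.act j g).hom.vertexMap x = x)
    (x x' : ∀ j, (D.tree j).Vertex)
    (hx : ∀ ⦃i j : D.J⦄ (h : i ≤ j), (D.trans h).vertexMap (x j) = x i)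
    (hx' : ∀ ⦃i j : D.J⦄ (h : i ≤ j), (D.trans h).vertexMap (x' j) = x' i)
    (hfx : ∀ g ∈ C, ∀ j, (D.act j g).hom.vertexMap (x j) = x j)
    (hfx' : ∀ g ∈ C, ∀ j, (D.act j g).hom.vertexMap (x' j) = x' j) (j : D.J) :
    x j = x' j ∨ ∃ (e : (D.tree j).Edge) (b b' : (D.tree j).Branch),
      (D.tree j).edgeOf b = e ∧ (D.tree j).edgeOf b' = e ∧
      (D.tree j).abuts b = some (x j) ∧ (D.tree j).abuts b' = some (x' j) := by
  obtain ⟨k, h, hcase⟩ := D.pointOrEdge_images_of_persistent level quot levelAct levelTrans levelProj h𝒢 C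
    hC1 quot_isImmersion act_quot trans_quot levelTrans_id levelTrans_comp quot_proj levelTrans_proj finV finB
    hlf stabC v hpers j
  rcases hcase with ⟨y, hy⟩ | ⟨e, he⟩
  · left
    rw [← hx h, ← hx' h, hy (x k) (fun g hg => hfx g hg k), hy (x' k) (fun g hg => hfx' g hg k)]
  · right
    obtain ⟨b, hbe, hb⟩ := he (x k) (fun g hg => hfx g hg k)
    obtain ⟨b', hb'e, hb'⟩ := he (x' k) (fun g hg => hfx' g hg k)
    rw [hx h] at hb
    rw [hx' h] at hb'
    exact ⟨e, b, b', hbe, hb'e, hb, hb'⟩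

/-- **`hadj` over a persistent vertex of a locally finite `𝔾`**: two compatible `C`-fixed vertex systems
differing at level `j` are the two ends of ONE edge of `𝒢_{∞,j}` through distinct branches, and that edge
is `C`-fixed (tree: `SemiGraph.edge_unique_of_abuts`). [cite: MochizukiSemiAnbd2006, Thm 3.7(iii) p.41] -/
theorem hadj_of_persistent_locFin (h𝒢 : 𝒢.Thm37Hypotheses) (C : Subgroup c.G) (hC1 : C ≠ ⊥)
    (quot_isImmersion : ∀ j, SemiGraph.IsImmersion (quot j))
    (act_quot : ∀ (j : D.J) (g : c.G), (D.act j g).hom ≫ quot j = quot j ≫ (levelAct j g).hom)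
    (trans_quot : ∀ ⦃i j : D.J⦄ (h : i ≤ j), D.trans h ≫ quot i = quot j ≫ levelTrans h)
    (levelTrans_id : ∀ j, levelTrans (le_refl j) = 𝟙 (level j))
    (levelTrans_comp : ∀ ⦃i j k : D.J⦄ (hij : i ≤ j) (hjk : j ≤ k),
      levelTrans hjk ≫ levelTrans hij = levelTrans (hij.trans hjk))
    (quot_proj : ∀ j, quot j ≫ levelProj j = D.proj j)
    (levelTrans_proj : ∀ ⦃i j : D.J⦄ (h : i ≤ j), levelTrans h ≫ levelProj i = levelProj j)
    (finV : ∀ (j : D.J) (v : 𝒢.graph.Vertex), {w : (level j).Vertex | (levelProj j).vertexMap w = v}.Finite)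
    (finB : ∀ (j : D.J) (b : 𝒢.graph.Branch), {β : (level j).Branch | (levelProj j).branchMap β = b}.Finite)
    (hlf : ∀ v : 𝒢.graph.Vertex, {b : 𝒢.graph.Branch | 𝒢.graph.abuts b = some v}.Finite)
    (stabC : ∀ (j₀ : D.J) (w : ∀ i : {i : D.J // j₀ ≤ i}, (level i.1).Vertex)
      (β β' : ∀ i : {i : D.J // j₀ ≤ i}, (level i.1).Branch),
      (∀ i, β i ≠ β' i ∧ (level i.1).abuts (β i) = some (w i) ∧ (level i.1).abuts (β' i) = some (w i)) →
      (∀ ⦃i i' : {i : D.J // j₀ ≤ i}⦄ (h : i.1 ≤ i'.1), (levelTrans h).vertexMap (w i') = w i ∧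
        (levelTrans h).branchMap (β i') = β i ∧ (levelTrans h).branchMap (β' i') = β' i) →
      ∃ (Q : Type u) (_ : Group Q) (ιQ : c.G →* Q) (v : 𝒢.graph.Vertex) (b b' : 𝒢.graph.Branch)
        (hb : 𝒢.graph.abuts b = some v) (hb' : 𝒢.graph.abuts b' = some v) (ψ : 𝒢.Gv v →* Q) (x x' : 𝒢.Gv v),
        Set.InjOn ιQ C ∧ Function.Injective ψ ∧ (b' ≠ b ∨ x⁻¹ * x' ∉ 𝒢.branchSubgroup b v hb) ∧
        ∀ g ∈ C, (∀ i, (levelAct i.1 g).hom.vertexMap (w i) = w i ∧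
          (levelAct i.1 g).hom.branchMap (β i) = β i ∧ (levelAct i.1 g).hom.branchMap (β' i) = β' i) →
          ιQ g ∈ ((𝒢.branchSubgroup b v hb).map (MulAut.conj x).toMonoidHom).map ψ ⊓
            ((𝒢.branchSubgroup b' v hb').map (MulAut.conj x').toMonoidHom).map ψ)
    (v : 𝒢.graph.Vertex)
    (hpers : ∀ j, ∃ x : (D.tree j).Vertex, (D.proj j).vertexMap x = v ∧
      ∀ g ∈ C, (D.act j g).hom.vertexMap x = x)
    (x x' : ∀ j, (D.tree j).Vertex)
    (hx : ∀ ⦃i j : D.J⦄ (h : i ≤ j), (D.trans h).vertexMap (x j) = x i)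
    (hx' : ∀ ⦃i j : D.J⦄ (h : i ≤ j), (D.trans h).vertexMap (x' j) = x' i)
    (hfx : ∀ g ∈ C, ∀ j, (D.act j g).hom.vertexMap (x j) = x j)
    (hfx' : ∀ g ∈ C, ∀ j, (D.act j g).hom.vertexMap (x' j) = x' j)
    (j : D.J) (hne : x j ≠ x' j) :
    ∃ (e : (D.tree j).Edge) (b b' : (D.tree j).Branch), b ≠ b' ∧
      (D.tree j).edgeOf b = e ∧ (D.tree j).edgeOf b' = e ∧
      (D.tree j).abuts b = some (x j) ∧ (D.tree j).abuts b' = some (x' j) ∧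
      ∀ g ∈ C, (D.act j g).hom.edgeMap e = e := by
  rcases D.pointOrEdge_aux' level quot levelAct levelTrans levelProj h𝒢 C hC1 quot_isImmersion act_quot
      trans_quot levelTrans_id levelTrans_comp quot_proj levelTrans_proj finV finB hlf stabC v hpers x x' hx
      hx' hfx hfx' j with heq | ⟨e, b, b', hbe, hb'e, hb, hb'⟩
  · exact absurd heq hne
  · have hbb' : b ≠ b' := by
      rintro rfl
      rw [hb] at hb'
      exact hne (Option.some_injective _ hb')
    refine ⟨e, b, b', hbb', hbe, hb'e, hb, hb', fun g hg => ?_⟩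
    set ψ := (D.act j g).hom with hψ
    have h₁ : (D.tree j).abuts (ψ.branchMap b) = some (x j) := by
      rw [ψ.abuts_branchMap b (x j) hb, hfx g hg j]
    have h₂ : (D.tree j).abuts (ψ.branchMap b') = some (x' j) := by
      rw [ψ.abuts_branchMap b' (x' j) hb', hfx' g hg j]
    exact (SemiGraph.edge_unique_of_abuts (D.isTree j) hne hbe hb'e
      ((ψ.edgeOf_branchMap b).trans (by rw [hbe])) ((ψ.edgeOf_branchMap b').trans (by rw [hb'e]))
      hb hb' h₁ h₂).symm

end Levels

end VerticialLevelData

end ProfiniteSemiGraph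

end Literature.AnabelianGeometry.SemiGraphs
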